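import Summits.Ventures.HSemireg.Pad4TowerFCCoreSeam
import Summits.Ventures.HSemireg.Pad4TowerDiamondMu4
import Summits.Ventures.HSemireg.Pad4TowerLineLetters

/-!
# HALF-SUM LATTICE LAW: `μ ∈ 32ℤ[i]` for EVERY integer (A1)-clean design with parity-axial letters (control g6, 2026-08-29)

Nothing here proves HC, HC_AV, HC_CM, H2 or 18881; census-neutral; no fact, no instance, no notation.  SORRY-FREE target.
Pen proof, machine lattice computation and data: `Cruxes/BlochSeedDiscOne/BOX-LAW-g6.md` §10.

THE MECHANISM (no torus, no flow, no line, no height): for a letter `x = (α, β)`, `β = x₁ + i x₂`, put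
`G(x) = 2α + (1 − i)β + (1 + i)β̄ = 2(α + x₁ + x₂)` and `G'(x) = 2α + (1 + i)β + (1 − i)β̄ = 2(α + x₁ − x₂)` — honest letter
functionals, and for a PARITY-AXIAL letter (`β` on an axis, `α ≡ |β| (mod 2)` — every letter of every `◇_h`) `4 ∣ G(x)`, `4 ∣ G'(x)`
and `4 ∣ p(x) = α² − |β|²`.  Expanding a product of letter functionals over the class words and applying the screen (A1):
* `Σ ν ∏_f G(x_f)            = 16·N(uuuu) − 4μ − 4μ̄`   (`halfSum_GGGG`),
* `Σ ν G(x₀)G(x₁)G(x₂)G'(x₃)  = 16·N(uuuu) − 4iμ + 4iμ̄`  (`halfSum_GGGG'`),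
* `Σ ν G(x₀)G(x₁)·p(x₂)·1     = 4·N(uup1) = 4·N(uuuu)`   (`halfSum_GGp1`, (A1)(ii): `uup1`, `uuuu` are e-free of degree 4),
so `16 ∣ N(uuuu)`, `re μ = 2 N(uuuu) − (1∕8) Σν∏G`, `im μ = (1∕8) Σν GGGG' − 2 N(uuuu)`, and **`32 ∣ re μ`, `32 ∣ im μ`**
(`parityAxialDesign_mu_dvd`; `diamondDesign_mu_mem32` for designs supported in any `◇_h`, `h` even or odd).
Machine side (exact, `ctl/fulllattice.py`): the lattice of `(N(cccc), μ)` over ALL integer (A1)-clean designs on `◇_h` is EXACTLY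
`16ℤ × 32ℤ × 32ℤ·i` for every even `h ≤ 16` (`ℤ × 32ℤ[i]` for odd `h`) — so `32ℤ[i]` is sharp.
-/

namespace Summit.HodgeConjecture.HodgeConjecture.Cruxes.BlochSeedDiscOne.HalfSum

open Finset BigOperators Summit.Ventures.HSemireg Summit.Ventures.HSemireg.Pad4Tower

/-! ## §1 letter functionals and their expansion over class words -/

/-- the class tensor of a cell is the product of its four letters. -/
theorem ch_eq_prod (Z : MCell) (w : CWord) : Z.ch w = ∏ f, bphi (Z f) (w f) := by
  rw [Fin.prod_univ_four]; rfl

/-- a LETTER FUNCTIONAL `Σ_j c_j · (letter j of x)` on the six class letters `1, u, v, e, ē, p`. -/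
def lfun (c : Fin 6 → GaussianInt) (x : BPoint) : GaussianInt := ∑ j, c j * bphi x j

/-- per cell: a product of four letter functionals expands over the class words. -/
theorem prod_lfun (c : Fin 4 → Fin 6 → GaussianInt) (Z : MCell) :
    ∏ f, lfun (c f) (Z f) = ∑ w : CWord, (∏ f, c f (w f)) * Z.ch w := by
  simp only [lfun]
  rw [Finset.prod_univ_sum]
  simp only [Fintype.piFinset_univ]
  refine Finset.sum_congr rfl fun w _ => ?_
  rw [ch_eq_prod, ← Finset.prod_mul_distrib]

/-- the design-level pairing with a product of letter functionals. -/
def HS (C : MConfig) (mN mP : MCell → ℤ) (c : Fin 4 → Fin 6 → GaussianInt) : GaussianInt :=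
  ∑ Z ∈ C.lower, (mN Z : GaussianInt) * ∏ f, lfun (c f) (Z f) -
    ∑ P ∈ C.upper, (mP P : GaussianInt) * ∏ f, lfun (c f) (P f)

/-- the class function evaluated at a word. -/
theorem wch_apply (C : MConfig) (mN mP : MCell → ℤ) (w : CWord) :
    C.wch mN mP w = ∑ Z ∈ C.lower, (mN Z : GaussianInt) * Z.ch w - ∑ P ∈ C.upper, (mP P : GaussianInt) * P.ch w := by
  simp only [MConfig.wch, Pi.sub_apply, Finset.sum_apply, Pi.smul_apply]
  simp only [zsmul_eq_mul]

/-- **expansion**: `HS(c) = Σ_w (∏_f c_f(w_f)) · N(w)`. -/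
theorem HS_expand (C : MConfig) (mN mP : MCell → ℤ) (c : Fin 4 → Fin 6 → GaussianInt) :
    HS C mN mP c = ∑ w : CWord, (∏ f, c f (w f)) * C.wch mN mP w := by
  simp only [HS, prod_lfun, wch_apply, Finset.mul_sum, mul_sub, Finset.sum_sub_distrib]
  congr 1
  · rw [Finset.sum_comm]
    refine Finset.sum_congr rfl fun w _ => Finset.sum_congr rfl fun Z _ => by ring
  · rw [Finset.sum_comm]
    refine Finset.sum_congr rfl fun w _ => Finset.sum_congr rfl fun Z _ => by ring

/-- under the screen (A1)(i), only e-free words and `eeee`, `ēēēē` contribute. -/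
theorem HS_expand_screen (C : MConfig) (mN mP : MCell → ℤ) (c : Fin 4 → Fin 6 → GaussianInt)
    (hA1 : ClassScreen (C.wch mN mP)) :
    HS C mN mP c = ∑ w ∈ (Finset.univ.filter fun w : CWord => EFree w ∨ w = eWord ∨ w = ebarWord),
      (∏ f, c f (w f)) * C.wch mN mP w := by
  rw [HS_expand, ← Finset.sum_filter_add_sum_filter_not Finset.univ
    (fun w : CWord => EFree w ∨ w = eWord ∨ w = ebarWord)]
  rw [add_eq_left]
  refine Finset.sum_eq_zero fun w hw => ?_
  rw [Finset.mem_filter] at hw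
  push_neg at hw
  rw [hA1.1 w hw.2.1 hw.2.2.1 hw.2.2.2, mul_zero]

/-! ## §2 the three functionals `G`, `G'`, `p`, `1` as coefficient vectors -/

/-- `G = 2u + (1 − i)e + (1 + i)ē`. -/
def cG : Fin 6 → GaussianInt := ![0, 2, 0, ⟨1, -1⟩, ⟨1, 1⟩, 0]
/-- `G' = 2u + (1 + i)e + (1 − i)ē`. -/
def cG' : Fin 6 → GaussianInt := ![0, 2, 0, ⟨1, 1⟩, ⟨1, -1⟩, 0]
/-- the letter `p`. -/
def cP : Fin 6 → GaussianInt := ![0, 0, 0, 0, 0, 1]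
/-- the letter `1`. -/
def c1 : Fin 6 → GaussianInt := ![1, 0, 0, 0, 0, 0]

/-- `G(x) = 2(α + x₁ + x₂)`. -/
theorem lfun_cG (x : BPoint) : lfun cG x = ((2 * (x.1 + x.2.1 + x.2.2) : ℤ) : GaussianInt) := by
  rw [lfun, Fin.sum_univ_six, Zsqrtd.ext_iff]
  simp [cG, bphi, phiVec]
  constructor <;> ring

/-- `G'(x) = 2(α + x₁ − x₂)`. -/
theorem lfun_cG' (x : BPoint) : lfun cG' x = ((2 * (x.1 + x.2.1 - x.2.2) : ℤ) : GaussianInt) := by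
  rw [lfun, Fin.sum_univ_six, Zsqrtd.ext_iff]
  simp [cG', bphi, phiVec]
  constructor <;> ring

/-- `p(x) = α² − |β|²`. -/
theorem lfun_cP (x : BPoint) : lfun cP x = ((x.1 ^ 2 - x.2.1 ^ 2 - x.2.2 ^ 2 : ℤ) : GaussianInt) := by
  rw [lfun, Fin.sum_univ_six]
  simp [cP, bphi, phiVec]

/-- `1(x) = 1`. -/
theorem lfun_c1 (x : BPoint) : lfun c1 x = 1 := by
  rw [lfun, Fin.sum_univ_six]
  simp [c1, bphi, phiVec]

/-- the word `uuuu`. -/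
def uWord : CWord := ![1, 1, 1, 1]
/-- the word `uup1`. -/
def uupWord : CWord := ![1, 1, 5, 0]

theorem uWord_eFree : EFree uWord ∧ wdeg uWord = 4 := by decide
theorem uupWord_eFree : EFree uupWord ∧ wdeg uupWord = 4 := by decide

/-- (A1)(ii): `N(uup1) = N(uuuu)`. -/
theorem wch_uup_eq (C : MConfig) (mN mP : MCell → ℤ) (hA1 : ClassScreen (C.wch mN mP)) :
    C.wch mN mP uupWord = C.wch mN mP uWord :=
  hA1.2 _ _ uupWord_eFree.1 uWord_eFree.1 (by rw [uupWord_eFree.2, uWord_eFree.2])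

/-! ## §3 evaluating the three expansions -/

/-- the coefficient `∏_f c_f(w_f)` of the `GGGG`-type functionals vanishes off words in the letters `u, e, ē`. -/
theorem prod_coef_eq_zero {c : Fin 4 → Fin 6 → GaussianInt} {w : CWord}
    (h : ∃ f, c f (w f) = 0) : (∏ f, c f (w f)) = 0 := by
  obtain ⟨f, hf⟩ := h
  exact Finset.prod_eq_zero (Finset.mem_univ f) hf

/-- the surviving words of `GGGG` / `GGGG'`: among e-free ∪ {eeee, ēēēē}, a word with all letters in `{u, e, ē}` is
`uuuu`, `eeee` or `ēēēē`. -/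
theorem words_ueE (w : CWord) (hw : ∀ f, w f = 1 ∨ w f = 3 ∨ w f = 4)
    (hs : EFree w ∨ w = eWord ∨ w = ebarWord) : w = uWord ∨ w = eWord ∨ w = ebarWord := by
  rcases hs with he | he | he
  · left
    funext f
    have h1 := hw f; have h2 := he f
    rcases h1 with h | h | h
    · rw [h]; fin_cases f <;> rfl
    · exact absurd h h2.1
    · exact absurd h h2.2
  · exact Or.inr (Or.inl he)
  · exact Or.inr (Or.inr he)

theorem cG_support (j : Fin 6) (hj : cG j ≠ 0) : j = 1 ∨ j = 3 ∨ j = 4 := by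
  fin_cases j <;> simp_all [cG] <;> decide
theorem cG'_support (j : Fin 6) (hj : cG' j ≠ 0) : j = 1 ∨ j = 3 ∨ j = 4 := by
  fin_cases j <;> simp_all [cG'] <;> decide

/-- general evaluation: if every `c_f` is supported on `{u, e, ē}` then under (A1)
`HS(c) = (∏ c_f(u)) N(uuuu) + (∏ c_f(e)) μ + (∏ c_f(ē)) μ̄`. -/
theorem HS_ueE (C : MConfig) (mN mP : MCell → ℤ) (c : Fin 4 → Fin 6 → GaussianInt)
    (hc : ∀ f j, c f j ≠ 0 → j = 1 ∨ j = 3 ∨ j = 4) (hA1 : ClassScreen (C.wch mN mP)) :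
    HS C mN mP c = (∏ f, c f 1) * C.wch mN mP uWord + (∏ f, c f 3) * C.wch mN mP eWord
      + (∏ f, c f 4) * C.wch mN mP ebarWord := by
  rw [HS_expand_screen C mN mP c hA1]
  have hsub : ∀ w ∈ Finset.univ.filter (fun w : CWord => EFree w ∨ w = eWord ∨ w = ebarWord),
      w ∉ ({uWord, eWord, ebarWord} : Finset CWord) → (∏ f, c f (w f)) * C.wch mN mP w = 0 := by
    intro w hw hn
    rw [Finset.mem_filter] at hw
    have : ∃ f, c f (w f) = 0 := by
      by_contra hne
      push_neg at hne
      have hw' : ∀ f, w f = 1 ∨ w f = 3 ∨ w f = 4 := fun f => hc f (w f) (hne f)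
      rcases words_ueE w hw' hw.2 with h | h | h <;> simp [h] at hn
    rw [prod_coef_eq_zero this, zero_mul]
  rw [← Finset.sum_subset (s₁ := ({uWord, eWord, ebarWord} : Finset CWord)) _ hsub]
  · have h12 : uWord ≠ eWord := by decide
    have h13 : uWord ≠ ebarWord := by decide
    have h23 : eWord ≠ ebarWord := by decide
    rw [Finset.sum_insert (by simp [h12, h13]), Finset.sum_insert (by simp [h23]), Finset.sum_singleton]
    have e1 : (∏ f, c f (uWord f)) = ∏ f, c f 1 := Finset.prod_congr rfl fun f _ => by fin_cases f <;> rfl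
    have e2 : (∏ f, c f (eWord f)) = ∏ f, c f 3 := Finset.prod_congr rfl fun f _ => by fin_cases f <;> rfl
    have e3 : (∏ f, c f (ebarWord f)) = ∏ f, c f 4 := Finset.prod_congr rfl fun f _ => by fin_cases f <;> rfl
    rw [e1, e2, e3]; ring
  · intro w hw
    rw [Finset.mem_filter]
    refine ⟨Finset.mem_univ _, ?_⟩
    simp only [Finset.mem_insert, Finset.mem_singleton] at hw
    rcases hw with h | h | h
    · left; rw [h]; exact uWord_eFree.1
    · right; left; exact h
    · right; right; exact h

/-- **`Σν ∏ G = 16 N(uuuu) − 4μ − 4μ̄`.** -/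
theorem halfSum_GGGG (C : MConfig) (mN mP : MCell → ℤ) (hA1 : ClassScreen (C.wch mN mP)) :
    HS C mN mP (fun _ => cG) = 16 * C.wch mN mP uWord + (-4) * C.wch mN mP eWord + (-4) * C.wch mN mP ebarWord := by
  rw [HS_ueE C mN mP _ (fun _ j hj => cG_support j hj) hA1]
  have h1 : (∏ _f : Fin 4, cG 1) = 16 := by rw [Finset.prod_const, Finset.card_univ, Fintype.card_fin]; decide
  have h3 : (∏ _f : Fin 4, cG 3) = -4 := by rw [Finset.prod_const, Finset.card_univ, Fintype.card_fin]; decide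
  have h4 : (∏ _f : Fin 4, cG 4) = -4 := by rw [Finset.prod_const, Finset.card_univ, Fintype.card_fin]; decide
  rw [h1, h3, h4]

/-- the mixed coefficient vector `(G, G, G, G')`. -/
def cMix : Fin 4 → Fin 6 → GaussianInt := ![cG, cG, cG, cG']

/-- **`Σν GGGG' = 16 N(uuuu) − 4iμ + 4iμ̄`.** -/
theorem halfSum_GGGG' (C : MConfig) (mN mP : MCell → ℤ) (hA1 : ClassScreen (C.wch mN mP)) :
    HS C mN mP cMix = 16 * C.wch mN mP uWord + ⟨0, -4⟩ * C.wch mN mP eWord + ⟨0, 4⟩ * C.wch mN mP ebarWord := by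
  have hc : ∀ f j, cMix f j ≠ 0 → j = 1 ∨ j = 3 ∨ j = 4 := fun f j hj => by
    fin_cases f
    · exact cG_support j hj
    · exact cG_support j hj
    · exact cG_support j hj
    · exact cG'_support j hj
  rw [HS_ueE C mN mP _ hc hA1]
  have h1 : (∏ f : Fin 4, cMix f 1) = 16 := by rw [Fin.prod_univ_four]; decide
  have h3 : (∏ f : Fin 4, cMix f 3) = ⟨0, -4⟩ := by rw [Fin.prod_univ_four]; decide
  have h4 : (∏ f : Fin 4, cMix f 4) = ⟨0, 4⟩ := by rw [Fin.prod_univ_four]; decide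
  rw [h1, h3, h4]

/-- the coefficient vector `(G, G, p, 1)`. -/
def cUUP : Fin 4 → Fin 6 → GaussianInt := ![cG, cG, cP, c1]

/-- **`Σν G G p 1 = 4 N(uup1)`.** -/
theorem halfSum_GGp1 (C : MConfig) (mN mP : MCell → ℤ) (hA1 : ClassScreen (C.wch mN mP)) :
    HS C mN mP cUUP = 4 * C.wch mN mP uupWord := by
  rw [HS_expand_screen C mN mP _ hA1]
  have hsub : ∀ w ∈ Finset.univ.filter (fun w : CWord => EFree w ∨ w = eWord ∨ w = ebarWord),
      w ∉ ({uupWord} : Finset CWord) → (∏ f, cUUP f (w f)) * C.wch mN mP w = 0 := by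
    intro w hw hn
    rw [Finset.mem_filter] at hw
    rw [Finset.mem_singleton] at hn
    have : ∃ f, cUUP f (w f) = 0 := by
      by_contra hne
      push_neg at hne
      have h2 : w 2 = 5 := by
        have := hne 2; revert this; generalize w 2 = j; fin_cases j <;> simp [cUUP, cP]
      have h3 : w 3 = 0 := by
        have := hne 3; revert this; generalize w 3 = j; fin_cases j <;> simp [cUUP, c1]
      have h0 : w 0 = 1 ∨ w 0 = 3 ∨ w 0 = 4 := cG_support _ (hne 0)
      have h1 : w 1 = 1 ∨ w 1 = 3 ∨ w 1 = 4 := cG_support _ (hne 1)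
      -- `w` is e-mixed unless `w 0 = w 1 = u`; it is neither `eeee` nor `ēēēē` (letter `p` at slot 2)
      have hne1 : w ≠ eWord := fun h => by rw [h] at h2; exact absurd h2 (by decide)
      have hne2 : w ≠ ebarWord := fun h => by rw [h] at h2; exact absurd h2 (by decide)
      rcases hw.2 with he | he | he
      · have e0 : w 0 = 1 := by rcases h0 with h | h | h; exact h; exact absurd h (he 0).1; exact absurd h (he 0).2
        have e1 : w 1 = 1 := by rcases h1 with h | h | h; exact h; exact absurd h (he 1).1; exact absurd h (he 1).2
        exact hn (funext fun f => by fin_cases f <;> simp [uupWord, e0, e1, h2, h3])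
      · exact hne1 he
      · exact hne2 he
    rw [prod_coef_eq_zero this, zero_mul]
  rw [← Finset.sum_subset (s₁ := ({uupWord} : Finset CWord)) _ hsub, Finset.sum_singleton]
  · have e1 : (∏ f, cUUP f (uupWord f)) = 4 := by rw [Fin.prod_univ_four]; decide
    rw [e1]
  · intro w hw
    rw [Finset.mem_singleton] at hw
    rw [Finset.mem_filter]
    exact ⟨Finset.mem_univ _, Or.inl (hw ▸ uupWord_eFree.1)⟩

/-! ## §4 the integers: parity-axial letters make `G, G', p` divisible by `4` -/

/-- a PARITY-AXIAL letter: `β` on an axis (or zero) and `α ≡ |β| (mod 2)` — every letter of every `◇_h`. -/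
def ParityAxial (x : BPoint) : Prop := (x.2.1 = 0 ∨ x.2.2 = 0) ∧ (2 : ℤ) ∣ x.1 + x.2.1 + x.2.2

theorem four_dvd_G {x : BPoint} (hx : ParityAxial x) : (4 : ℤ) ∣ 2 * (x.1 + x.2.1 + x.2.2) := by
  obtain ⟨k, hk⟩ := hx.2; exact ⟨k, by rw [hk]; ring⟩

theorem four_dvd_G' {x : BPoint} (hx : ParityAxial x) : (4 : ℤ) ∣ 2 * (x.1 + x.2.1 - x.2.2) := by
  obtain ⟨k, hk⟩ := hx.2
  rcases hx.1 with h0 | h0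
  · exact ⟨k - x.2.2, by rw [h0] at hk ⊢; linarith⟩
  · exact ⟨k, by rw [h0] at hk ⊢; linarith⟩

theorem four_dvd_p {x : BPoint} (hx : ParityAxial x) : (4 : ℤ) ∣ x.1 ^ 2 - x.2.1 ^ 2 - x.2.2 ^ 2 := by
  obtain ⟨k, hk⟩ := hx.2
  rcases hx.1 with h0 | h0
  · rw [h0] at hk ⊢
    have : x.1 = 2 * k - x.2.2 := by linarith
    exact ⟨k ^ 2 - k * x.2.2, by rw [this]; ring⟩
  · rw [h0] at hk ⊢
    have : x.1 = 2 * k - x.2.1 := by linarith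
    exact ⟨k ^ 2 - k * x.2.1, by rw [this]; ring⟩

/-- the integer behind `HS(c)` when every letter functional is integer-valued. -/
def HSint (C : MConfig) (mN mP : MCell → ℤ) (g : Fin 4 → BPoint → ℤ) : ℤ :=
  ∑ Z ∈ C.lower, mN Z * ∏ f, g f (Z f) - ∑ P ∈ C.upper, mP P * ∏ f, g f (P f)

theorem HS_eq_HSint (C : MConfig) (mN mP : MCell → ℤ) (c : Fin 4 → Fin 6 → GaussianInt) (g : Fin 4 → BPoint → ℤ)
    (hcg : ∀ f x, lfun (c f) x = ((g f x : ℤ) : GaussianInt)) :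
    HS C mN mP c = ((HSint C mN mP g : ℤ) : GaussianInt) := by
  unfold HS HSint
  push_cast
  simp_rw [hcg]

/-- a product of four integers each divisible by `4` is divisible by `256`. -/
theorem dvd256_prod4 (a : Fin 4 → ℤ) (h : ∀ f, (4 : ℤ) ∣ a f) : (256 : ℤ) ∣ ∏ f, a f := by
  rw [Fin.prod_univ_four, show (256 : ℤ) = 4 * 4 * 4 * 4 by norm_num]
  exact mul_dvd_mul (mul_dvd_mul (mul_dvd_mul (h 0) (h 1)) (h 2)) (h 3)

theorem dvd_HSint (C : MConfig) (mN mP : MCell → ℤ) (g : Fin 4 → BPoint → ℤ) (d : ℤ)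
    (hd : ∀ Z ∈ C.lower ∪ C.upper, d ∣ ∏ f, g f (Z f)) : d ∣ HSint C mN mP g := by
  unfold HSint
  apply dvd_sub
  · exact Finset.dvd_sum fun Z hZ => (hd Z (Finset.mem_union_left _ hZ)).mul_left _
  · exact Finset.dvd_sum fun P hP => (hd P (Finset.mem_union_right _ hP)).mul_left _

/-! ## §5 THE LAW -/

/-- the functionals as integer letter maps. -/
def gG : BPoint → ℤ := fun x => 2 * (x.1 + x.2.1 + x.2.2)
def gG' : BPoint → ℤ := fun x => 2 * (x.1 + x.2.1 - x.2.2)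
def gP : BPoint → ℤ := fun x => x.1 ^ 2 - x.2.1 ^ 2 - x.2.2 ^ 2
def g1 : BPoint → ℤ := fun _ => 1

/-- `N(uuuu)` is a (rational) integer: its imaginary part vanishes. -/
theorem wch_uWord_im (C : MConfig) (mN mP : MCell → ℤ) : (C.wch mN mP uWord).im = 0 := by
  rw [wch_apply]
  have hc : ∀ Z : MCell, Z.ch uWord = ((∏ f, (Z f).1 : ℤ) : GaussianInt) := fun Z => by
    rw [ch_eq_prod]; push_cast
    refine Finset.prod_congr rfl fun f _ => ?_
    fin_cases f <;> simp [uWord, bphi, phiVec]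
  simp_rw [hc]
  have : (∑ Z ∈ C.lower, (mN Z : GaussianInt) * ((∏ f, (Z f).1 : ℤ) : GaussianInt) -
      ∑ P ∈ C.upper, (mP P : GaussianInt) * ((∏ f, (P f).1 : ℤ) : GaussianInt)) =
      ((∑ Z ∈ C.lower, mN Z * ∏ f, (Z f).1 - ∑ P ∈ C.upper, mP P * ∏ f, (P f).1 : ℤ) : GaussianInt) := by
    push_cast; rfl
  rw [this, Zsqrtd.im_intCast]

/-- **HALF-SUM LATTICE LAW.**  For every integer (A1)-clean design all of whose letters are parity-axial:
`16 ∣ N(uuuu)`, `32 ∣ re μ`, `32 ∣ im μ` — with the exact identities `8 re μ = 16 N(uuuu) − Σν∏G`,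
`8 im μ = Σν GGGG' − 16 N(uuuu)`. -/
theorem parityAxialDesign_mu_dvd (C : MConfig) (mN mP : MCell → ℤ)
    (hpa : ∀ Z ∈ C.lower ∪ C.upper, ∀ f, ParityAxial (Z f)) (hA1 : ClassScreen (C.wch mN mP)) :
    (16 : ℤ) ∣ (C.wch mN mP uWord).re ∧ (32 : ℤ) ∣ (C.wch mN mP eWord).re ∧ (32 : ℤ) ∣ (C.wch mN mP eWord).im := by
  have hstar : C.wch mN mP ebarWord = star (C.wch mN mP eWord) := C.wch_ebarWord_eq_star mN mP
  have hqim : (C.wch mN mP uWord).im = 0 := wch_uWord_im C mN mP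
  -- (C): 4 N(uup1) = Σν G G p 1, an integer divisible by 4·4·4 ⇒ 16 ∣ N(uuuu)
  have eC := halfSum_GGp1 C mN mP hA1
  rw [wch_uup_eq C mN mP hA1, HS_eq_HSint C mN mP cUUP ![gG, gG, gP, g1] (fun f x => by
      fin_cases f
      · exact lfun_cG x
      · exact lfun_cG x
      · exact lfun_cP x
      · exact lfun_c1 x)] at eC
  have dC : (64 : ℤ) ∣ HSint C mN mP ![gG, gG, gP, g1] := dvd_HSint _ _ _ _ _ fun Z hZ => by
    rw [Fin.prod_univ_four, show (64 : ℤ) = 4 * 4 * 4 * 1 by norm_num]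
    exact mul_dvd_mul (mul_dvd_mul (mul_dvd_mul (four_dvd_G (hpa Z hZ 0)) (four_dvd_G (hpa Z hZ 1)))
      (four_dvd_p (hpa Z hZ 2))) (one_dvd _)
  have eCre := congrArg Zsqrtd.re eC
  norm_num at eCre
  have d16 : (16 : ℤ) ∣ (C.wch mN mP uWord).re := by
    obtain ⟨k, hk⟩ := dC
    rw [hk] at eCre
    exact ⟨k, by linarith⟩
  -- (A): Σν∏G = 16 q − 4μ − 4μ̄; real parts: HSint = 16 q.re − 8 μ.re
  have eA := halfSum_GGGG C mN mP hA1
  rw [HS_eq_HSint C mN mP (fun _ => cG) (fun _ => gG) (fun _ x => lfun_cG x), hstar] at eA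
  have dA : (256 : ℤ) ∣ HSint C mN mP (fun _ => gG) := dvd_HSint _ _ _ _ _ fun Z hZ =>
    dvd256_prod4 _ fun f => four_dvd_G (hpa Z hZ f)
  have eAre := congrArg Zsqrtd.re eA
  norm_num [hqim] at eAre
  -- (B): Σν GGGG' = 16 q − 4iμ + 4iμ̄; real parts: HSint = 16 q.re + 8 μ.im
  have eB := halfSum_GGGG' C mN mP hA1
  rw [HS_eq_HSint C mN mP cMix ![gG, gG, gG, gG'] (fun f x => by
      fin_cases f
      · exact lfun_cG x
      · exact lfun_cG x
      · exact lfun_cG x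
      · exact lfun_cG' x), hstar] at eB
  have dB : (256 : ℤ) ∣ HSint C mN mP ![gG, gG, gG, gG'] := dvd_HSint _ _ _ _ _ fun Z hZ => by
    rw [Fin.prod_univ_four, show (256 : ℤ) = 4 * 4 * 4 * 4 by norm_num]
    exact mul_dvd_mul (mul_dvd_mul (mul_dvd_mul (four_dvd_G (hpa Z hZ 0)) (four_dvd_G (hpa Z hZ 1)))
      (four_dvd_G (hpa Z hZ 2))) (four_dvd_G' (hpa Z hZ 3))
  have eBre := congrArg Zsqrtd.re eB
  norm_num [hqim] at eBre
  refine ⟨d16, ?_, ?_⟩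
  · obtain ⟨k, hk⟩ := dA
    obtain ⟨j, hj⟩ := d16
    rw [hk] at eAre
    exact ⟨j - k, by linarith⟩
  · obtain ⟨k, hk⟩ := dB
    obtain ⟨j, hj⟩ := d16
    rw [hk] at eBre
    exact ⟨k - j, by linarith⟩

/-- `|μ|² ≥ 1024` for every non-zero such `μ`. -/
theorem parityAxialDesign_norm_mu_ge (C : MConfig) (mN mP : MCell → ℤ)
    (hpa : ∀ Z ∈ C.lower ∪ C.upper, ∀ f, ParityAxial (Z f)) (hA1 : ClassScreen (C.wch mN mP))
    (hμ : C.wch mN mP eWord ≠ 0) : 1024 ≤ (C.wch mN mP eWord).norm := by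
  obtain ⟨-, ⟨a, ha⟩, ⟨b, hb⟩⟩ := parityAxialDesign_mu_dvd C mN mP hpa hA1
  rw [Zsqrtd.norm_def, ha, hb]
  have hab : a ≠ 0 ∨ b ≠ 0 := by
    by_contra h0
    push_neg at h0
    apply hμ
    rw [Zsqrtd.ext_iff, ha, hb, h0.1, h0.2]; simp
  rcases hab with h | h
  · have ha2 : 0 < a ^ 2 := by positivity
    nlinarith [sq_nonneg b]
  · have hb2 : 0 < b ^ 2 := by positivity
    nlinarith [sq_nonneg a]

/-! ## §6 every `◇_h` design qualifies (any `h`, even or odd) -/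

theorem parityAxial_of_inDiamond {h : ℤ} {x : BPoint} (hx : InDiamond h x) : ParityAxial x := by
  have hax : x.2.1 = 0 ∨ x.2.2 = 0 := by
    rcases hx.1 with h0 | hax
    · left; exact (Prod.ext_iff.mp h0).1
    · rcases hax with ⟨-, h2⟩ | ⟨h1, -⟩
      · exact Or.inr h2
      · exact Or.inl h1
  refine ⟨hax, ?_⟩
  have hpar := hx.2.2.1
  unfold absCharge chargeOf at hpar
  rcases hax with h0 | h0 <;> rw [h0] at hpar ⊢ <;> simp only [zero_sub, sub_zero, abs_neg, add_zero] at hpar ⊢ <;>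
    rcases abs_choice x.2.2 with e | e <;> rcases abs_choice x.2.1 with e' | e' <;> omega

/-- **COROLLARY (`◇_h`, every `h`)**: every integer (A1)-clean design supported in `◇_h` has `μ ∈ 32ℤ[i]` and `16 ∣ N(uuuu)`. -/
theorem diamondDesign_mu_mem32 (h : ℤ) (C : MConfig) (mN mP : MCell → ℤ)
    (hC : MConfig.InDiamond h C) (hA1 : ClassScreen (C.wch mN mP)) :
    (16 : ℤ) ∣ (C.wch mN mP uWord).re ∧ (32 : ℤ) ∣ (C.wch mN mP eWord).re ∧ (32 : ℤ) ∣ (C.wch mN mP eWord).im := by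
  have hD : ∀ Z ∈ C.lower ∪ C.upper, MCell.InDiamond h Z := fun Z hZ => by
    rcases Finset.mem_union.mp hZ with hZ | hZ
    · exact hC.1 Z hZ
    · exact hC.2 Z hZ
  exact parityAxialDesign_mu_dvd C mN mP (fun Z hZ f => parityAxial_of_inDiamond (hD Z hZ f)) hA1

/-! ## §7 the mass `M₀ = N(cccc)`: `16 ∣ M₀` for even `h` (§9 Q-B of the memo answered NO) -/

/-- `M₀ = Σν ∏_f (h − α_f)` (= `BandPhaseTorus.mass`, = the moment `N(cccc)`). -/
def M0 (h : ℤ) (C : MConfig) (mN mP : MCell → ℤ) : ℤ :=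
  (∑ Z ∈ C.lower, mN Z * ∏ f, LinePhaseTorus.lineCharge h Z f) - ∑ P ∈ C.upper, mP P * ∏ f, LinePhaseTorus.lineCharge h P f

theorem M0_eq_HSint (h : ℤ) (C : MConfig) (mN mP : MCell → ℤ) :
    M0 h C mN mP = HSint C mN mP (fun _ x => h - x.1) := by
  unfold M0 HSint LinePhaseTorus.lineCharge; rfl

/-- splitting the screened expansion: e-free words, plus `eeee ↦ μ`, `ēēēē ↦ μ̄`. -/
theorem sum_screenFilter (t : CWord → GaussianInt) :
    ∑ w ∈ (Finset.univ.filter fun w : CWord => EFree w ∨ w = eWord ∨ w = ebarWord), t w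
      = (∑ w ∈ (Finset.univ.filter fun w : CWord => EFree w), t w) + t eWord + t ebarWord := by
  have hne : eWord ≠ ebarWord := by decide
  have he : ¬ EFree eWord := by decide
  have hb : ¬ EFree ebarWord := by decide
  have hset : (Finset.univ.filter fun w : CWord => EFree w ∨ w = eWord ∨ w = ebarWord)
      = (Finset.univ.filter fun w : CWord => EFree w) ∪ {eWord, ebarWord} := by
    ext w
    simp only [Finset.mem_filter, Finset.mem_univ, true_and, Finset.mem_union, Finset.mem_insert,
      Finset.mem_singleton]
  have hdis : Disjoint (Finset.univ.filter fun w : CWord => EFree w) {eWord, ebarWord} := by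
    rw [Finset.disjoint_left]
    intro w hw
    rw [Finset.mem_filter] at hw
    simp only [Finset.mem_insert, Finset.mem_singleton, not_or]
    exact ⟨fun h0 => he (h0 ▸ hw.2), fun h0 => hb (h0 ▸ hw.2)⟩
  rw [hset, Finset.sum_union hdis, Finset.sum_pair hne]; ring

theorem HS_split (C : MConfig) (mN mP : MCell → ℤ) (c : Fin 4 → Fin 6 → GaussianInt)
    (hA1 : ClassScreen (C.wch mN mP)) :
    HS C mN mP c = (∑ w ∈ (Finset.univ.filter fun w : CWord => EFree w), (∏ f, c f (w f)) * C.wch mN mP w)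
      + (∏ f, c f 3) * C.wch mN mP eWord + (∏ f, c f 4) * C.wch mN mP ebarWord := by
  rw [HS_expand_screen C mN mP c hA1, sum_screenFilter]
  have e2 : (∏ f, c f (eWord f)) = ∏ f, c f 3 := Finset.prod_congr rfl fun f _ => by fin_cases f <;> rfl
  have e3 : (∏ f, c f (ebarWord f)) = ∏ f, c f 4 := Finset.prod_congr rfl fun f _ => by fin_cases f <;> rfl
  rw [e2, e3]

/-- the co-letter functional `c = h·1 − u` (value `h − α`). -/
def cH (h : ℤ) : Fin 6 → GaussianInt := ![(h : GaussianInt), -1, 0, 0, 0, 0]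
/-- `D = 2c − (1 − i)e − (1 + i)ē` (value `2(h − α − Re β − Im β) = 2h − G`). -/
def cD (h : ℤ) : Fin 6 → GaussianInt := ![2 * (h : GaussianInt), -2, 0, ⟨-1, 1⟩, ⟨-1, -1⟩, 0]

theorem lfun_cH (h : ℤ) (x : BPoint) : lfun (cH h) x = ((h - x.1 : ℤ) : GaussianInt) := by
  rw [lfun, Fin.sum_univ_six, Zsqrtd.ext_iff]
  simp [cH, bphi, phiVec]
  ring

theorem lfun_cD (h : ℤ) (x : BPoint) :
    lfun (cD h) x = ((2 * (h - x.1 - x.2.1 - x.2.2) : ℤ) : GaussianInt) := by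
  rw [lfun, Fin.sum_univ_six, Zsqrtd.ext_iff]
  simp [cD, bphi, phiVec]
  constructor <;> ring

theorem cD_eq_two_mul_cH (h : ℤ) (j : Fin 6) (h3 : j ≠ 3) (h4 : j ≠ 4) : cD h j = 2 * cH h j := by
  fin_cases j <;> first | exact absurd rfl h3 | exact absurd rfl h4 | (simp [cD, cH]) | (simp [cD, cH]; ring)

theorem efree_coef_cD (h : ℤ) (w : CWord) (hw : EFree w) :
    (∏ f, cD h (w f)) = 16 * ∏ f, cH h (w f) := by
  rw [Finset.prod_congr rfl fun f _ => cD_eq_two_mul_cH h (w f) (hw f).1 (hw f).2, Finset.prod_mul_distrib,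
    Finset.prod_const, Finset.card_univ, Fintype.card_fin]
  norm_num

/-- **`Σν ∏ D = 16·M₀ − 4μ − 4μ̄`.** -/
theorem halfSum_DDDD (h : ℤ) (C : MConfig) (mN mP : MCell → ℤ) (hA1 : ClassScreen (C.wch mN mP)) :
    HS C mN mP (fun _ => cD h) = 16 * HS C mN mP (fun _ => cH h) + (-4) * C.wch mN mP eWord
      + (-4) * C.wch mN mP ebarWord := by
  rw [HS_split C mN mP _ hA1, HS_split C mN mP _ hA1]
  have d3 : (∏ _f : Fin 4, cD h 3) = -4 := by
    rw [Finset.prod_const, Finset.card_univ, Fintype.card_fin]; simp [cD]; decide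
  have d4 : (∏ _f : Fin 4, cD h 4) = -4 := by
    rw [Finset.prod_const, Finset.card_univ, Fintype.card_fin]; simp [cD]; decide
  have c3 : (∏ _f : Fin 4, cH h 3) = 0 := by
    rw [Finset.prod_const, Finset.card_univ, Fintype.card_fin]; simp [cH]
  have c4 : (∏ _f : Fin 4, cH h 4) = 0 := by
    rw [Finset.prod_const, Finset.card_univ, Fintype.card_fin]; simp [cH]
  rw [d3, d4, c3, c4, zero_mul, zero_mul, add_zero, add_zero, Finset.mul_sum]
  congr 1; congr 1
  refine Finset.sum_congr rfl fun w hw => ?_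
  rw [Finset.mem_filter] at hw
  rw [efree_coef_cD h w hw.2, mul_assoc]

/-- **MASS LAW.**  For even `h` and every integer (A1)-clean design with parity-axial letters: `16 ∣ M₀ = Σν∏(h − α_f)`
(and `2M₀ ≡ (re μ)/… `: precisely `16 M₀ − 8 re μ ∈ 256ℤ`). -/
theorem parityAxialDesign_M0_dvd (h : ℤ) (hh : 2 ∣ h) (C : MConfig) (mN mP : MCell → ℤ)
    (hpa : ∀ Z ∈ C.lower ∪ C.upper, ∀ f, ParityAxial (Z f)) (hA1 : ClassScreen (C.wch mN mP)) :
    (16 : ℤ) ∣ M0 h C mN mP := by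
  obtain ⟨-, ⟨j, hj⟩, -⟩ := parityAxialDesign_mu_dvd C mN mP hpa hA1
  have hstar : C.wch mN mP ebarWord = star (C.wch mN mP eWord) := C.wch_ebarWord_eq_star mN mP
  have eD := halfSum_DDDD h C mN mP hA1
  rw [HS_eq_HSint C mN mP (fun _ => cD h) (fun _ x => 2 * (h - x.1 - x.2.1 - x.2.2)) (fun _ x => lfun_cD h x),
    HS_eq_HSint C mN mP (fun _ => cH h) (fun _ x => h - x.1) (fun _ x => lfun_cH h x), ← M0_eq_HSint, hstar] at eD
  have dD : (256 : ℤ) ∣ HSint C mN mP (fun _ x => 2 * (h - x.1 - x.2.1 - x.2.2)) :=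
    dvd_HSint _ _ _ _ _ fun Z hZ => dvd256_prod4 _ fun f => by
      obtain ⟨a, ha⟩ := hh
      obtain ⟨b, hb⟩ := (hpa Z hZ f).2
      exact ⟨a - b, by linarith⟩
  have eDre := congrArg Zsqrtd.re eD
  norm_num at eDre
  obtain ⟨k, hk⟩ := dD
  rw [hk, hj] at eDre
  exact ⟨k + j, by linarith⟩

/-- **COROLLARY (`◇_h`, `h` even)**: `(M₀, μ) ∈ 16ℤ × 32ℤ[i]` — the full clean-design lattice computed by `fulllattice.py` is exactly this. -/
theorem diamondDesign_M0_mu_mem (h : ℤ) (hh : 2 ∣ h) (C : MConfig) (mN mP : MCell → ℤ)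
    (hC : MConfig.InDiamond h C) (hA1 : ClassScreen (C.wch mN mP)) :
    (16 : ℤ) ∣ M0 h C mN mP ∧ (32 : ℤ) ∣ (C.wch mN mP eWord).re ∧ (32 : ℤ) ∣ (C.wch mN mP eWord).im := by
  have hD : ∀ Z ∈ C.lower ∪ C.upper, MCell.InDiamond h Z := fun Z hZ => by
    rcases Finset.mem_union.mp hZ with hZ | hZ
    · exact hC.1 Z hZ
    · exact hC.2 Z hZ
  have hpa : ∀ Z ∈ C.lower ∪ C.upper, ∀ f, ParityAxial (Z f) := fun Z hZ f => parityAxial_of_inDiamond (hD Z hZ f)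
  exact ⟨parityAxialDesign_M0_dvd h hh C mN mP hpa hA1, (parityAxialDesign_mu_dvd C mN mP hpa hA1).2⟩

/-! ## §8 the e-free ladder: `N(e-free word of degree k) ∈ 2^k ℤ` (`k = 1, …, 8`; `k = 4` is §5) -/

/-- the integer letter table on e-free letters. -/
def iphi (x : BPoint) : Fin 6 → ℤ := ![1, x.1, x.1, 0, 0, x.1 ^ 2 - x.2.1 ^ 2 - x.2.2 ^ 2]

theorem bphi_eq_iphi (x : BPoint) (j : Fin 6) (h3 : j ≠ 3) (h4 : j ≠ 4) :
    bphi x j = ((iphi x j : ℤ) : GaussianInt) := by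
  fin_cases j <;> first | exact absurd rfl h3 | exact absurd rfl h4 | simp [bphi, phiVec, iphi]

/-- e-free class values are rational integers. -/
theorem ch_efree_eq (Z : MCell) (w : CWord) (hw : EFree w) :
    Z.ch w = ((∏ f, iphi (Z f) (w f) : ℤ) : GaussianInt) := by
  rw [ch_eq_prod]; push_cast
  exact Finset.prod_congr rfl fun f _ => bphi_eq_iphi _ _ (hw f).1 (hw f).2

theorem wch_efree_eq (C : MConfig) (mN mP : MCell → ℤ) (w : CWord) (hw : EFree w) :
    C.wch mN mP w = ((∑ Z ∈ C.lower, mN Z * ∏ f, iphi (Z f) (w f) -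
      ∑ P ∈ C.upper, mP P * ∏ f, iphi (P f) (w f) : ℤ) : GaussianInt) := by
  rw [wch_apply]
  simp_rw [ch_efree_eq _ w hw]
  push_cast
  rfl

theorem wch_efree_im (C : MConfig) (mN mP : MCell → ℤ) (w : CWord) (hw : EFree w) : (C.wch mN mP w).im = 0 := by
  rw [wch_efree_eq C mN mP w hw, Zsqrtd.im_intCast]

/-- single-survivor evaluation: if every `c_f` is supported on `{j_f, e, ē}` with `j` e-free and some slot carries no `e, ē`
coefficient, then under (A1) `HS(c) = (∏ c_f(j_f)) · N(j)`. -/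
theorem HS_single (C : MConfig) (mN mP : MCell → ℤ) (c : Fin 4 → Fin 6 → GaussianInt) (j : CWord) (hj : EFree j)
    (hc : ∀ f k, c f k ≠ 0 → k = j f ∨ k = 3 ∨ k = 4) (f₀ : Fin 4) (h3 : c f₀ 3 = 0) (h4 : c f₀ 4 = 0)
    (hA1 : ClassScreen (C.wch mN mP)) :
    HS C mN mP c = (∏ f, c f (j f)) * C.wch mN mP j := by
  rw [HS_split C mN mP c hA1, Finset.prod_eq_zero (Finset.mem_univ f₀) h3, Finset.prod_eq_zero (Finset.mem_univ f₀) h4,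
    zero_mul, zero_mul, add_zero, add_zero]
  rw [Finset.sum_eq_single j]
  · intro w hw hne
    rw [Finset.mem_filter] at hw
    have : ∃ f, c f (w f) = 0 := by
      by_contra hcon
      push_neg at hcon
      apply hne
      funext f
      rcases hc f (w f) (hcon f) with e | e | e
      · exact e
      · exact absurd e (hw.2 f).1
      · exact absurd e (hw.2 f).2
    rw [prod_coef_eq_zero this, zero_mul]
  · intro hnot
    exact absurd (Finset.mem_filter.mpr ⟨Finset.mem_univ _, hj⟩) hnot

/-- the ladder engine: `(∏ d_f) ∣ a · N(j)` whenever `HS(c) = a·N(j)`, the functionals are integer-valued (`g`) and `d_f ∣ g_f`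
letterwise on parity-axial letters. -/
theorem ladder_core (C : MConfig) (mN mP : MCell → ℤ)
    (hpa : ∀ Z ∈ C.lower ∪ C.upper, ∀ f, ParityAxial (Z f)) (hA1 : ClassScreen (C.wch mN mP))
    (c : Fin 4 → Fin 6 → GaussianInt) (g : Fin 4 → BPoint → ℤ) (hcg : ∀ f x, lfun (c f) x = ((g f x : ℤ) : GaussianInt))
    (d : Fin 4 → ℤ) (hd : ∀ f x, ParityAxial x → d f ∣ g f x)
    (j : CWord) (hj : EFree j) (hc : ∀ f k, c f k ≠ 0 → k = j f ∨ k = 3 ∨ k = 4) (f₀ : Fin 4)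
    (h3 : c f₀ 3 = 0) (h4 : c f₀ 4 = 0) (a : ℤ) (ha : (∏ f, c f (j f)) = (a : GaussianInt)) :
    (∏ f, d f) ∣ a * (C.wch mN mP j).re := by
  have e := HS_single C mN mP c j hj hc f₀ h3 h4 hA1
  rw [HS_eq_HSint C mN mP c g hcg, ha] at e
  have dv : (∏ f, d f) ∣ HSint C mN mP g :=
    dvd_HSint _ _ _ _ _ fun Z hZ => Finset.prod_dvd_prod_of_dvd _ _ fun f _ => hd f _ (hpa Z hZ f)
  have ere := congrArg Zsqrtd.re e
  have : ((a : GaussianInt) * C.wch mN mP j).re = a * (C.wch mN mP j).re := by simp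
  rw [Zsqrtd.re_intCast, this] at ere
  rwa [ere] at dv

/-- `2 ∣ 4·?`-type cancellations. -/
theorem dvd_of_mul_dvd_mul {a b n : ℤ} (ha : a ≠ 0) (h : a * b ∣ a * n) : b ∣ n :=
  (mul_dvd_mul_iff_left ha).mp h

/-- the words `u111, uu11, uuu1, uuup, uupp, uppp, pppp`. -/
def lw1 : CWord := ![1, 0, 0, 0]
def lw2 : CWord := ![1, 1, 0, 0]
def lw3 : CWord := ![1, 1, 1, 0]
def lw5 : CWord := ![1, 1, 1, 5]
def lw6 : CWord := ![1, 1, 5, 5]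
def lw7 : CWord := ![1, 5, 5, 5]
def lw8 : CWord := ![5, 5, 5, 5]

theorem c1_support (k : Fin 6) (hk : c1 k ≠ 0) : k = 0 := by
  fin_cases k <;> simp_all [c1]
theorem cP_support (k : Fin 6) (hk : cP k ≠ 0) : k = 5 := by
  fin_cases k <;> simp_all [cP]

/-- **THE LADDER** (with §5's `16 ∣ N(uuuu)`): `2 ∣ N(u111)`, `4 ∣ N(uu11)`, `8 ∣ N(uuu1)`, `32 ∣ N(uuup)`, `64 ∣ N(uupp)`,
`128 ∣ N(uppp)`, `256 ∣ N(pppp)` — and by (A1)(ii) the same for every e-free word of the same degree. -/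
theorem parityAxialDesign_ladder (C : MConfig) (mN mP : MCell → ℤ)
    (hpa : ∀ Z ∈ C.lower ∪ C.upper, ∀ f, ParityAxial (Z f)) (hA1 : ClassScreen (C.wch mN mP)) :
    (2 : ℤ) ∣ (C.wch mN mP lw1).re ∧ (4 : ℤ) ∣ (C.wch mN mP lw2).re ∧ (8 : ℤ) ∣ (C.wch mN mP lw3).re ∧
    (32 : ℤ) ∣ (C.wch mN mP lw5).re ∧ (64 : ℤ) ∣ (C.wch mN mP lw6).re ∧ (128 : ℤ) ∣ (C.wch mN mP lw7).re ∧
    (256 : ℤ) ∣ (C.wch mN mP lw8).re := by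
  have LC := ladder_core C mN mP hpa hA1
  -- letterwise divisibilities
  have dG : ∀ x, ParityAxial x → (4 : ℤ) ∣ gG x := fun x hx => four_dvd_G hx
  have dP : ∀ x, ParityAxial x → (4 : ℤ) ∣ gP x := fun x hx => four_dvd_p hx
  have d1 : ∀ x, ParityAxial x → (1 : ℤ) ∣ g1 x := fun x _ => one_dvd _
  have sG : ∀ k, cG k ≠ 0 → k = 1 ∨ k = 3 ∨ k = 4 := cG_support
  have s1 : ∀ (j : Fin 6) k, j = 0 → c1 k ≠ 0 → k = j ∨ k = 3 ∨ k = 4 := fun j k hj hk => Or.inl (hj ▸ c1_support k hk)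
  have sP : ∀ (j : Fin 6) k, j = 5 → cP k ≠ 0 → k = j ∨ k = 3 ∨ k = 4 := fun j k hj hk => Or.inl (hj ▸ cP_support k hk)
  refine ⟨?_, ?_, ?_, ?_, ?_, ?_, ?_⟩
  · have h := LC ![cG, c1, c1, c1] ![gG, g1, g1, g1]
      (fun f x => by fin_cases f <;> first | exact lfun_cG x | exact lfun_c1 x) ![4, 1, 1, 1]
      (fun f x hx => by fin_cases f <;> first | exact dG x hx | exact d1 x hx) lw1 (by decide)
      (fun f k hk => by fin_cases f <;> first | exact sG k hk | exact s1 _ k rfl hk) 1 rfl rfl 2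
      (by rw [Fin.prod_univ_four]; decide)
    rw [Fin.prod_univ_four] at h; norm_num at h
    exact dvd_of_mul_dvd_mul (a := 2) (by norm_num) (by simpa [show (4 : ℤ) = 2 * 2 by norm_num] using h)
  · have h := LC ![cG, cG, c1, c1] ![gG, gG, g1, g1]
      (fun f x => by fin_cases f <;> first | exact lfun_cG x | exact lfun_c1 x) ![4, 4, 1, 1]
      (fun f x hx => by fin_cases f <;> first | exact dG x hx | exact d1 x hx) lw2 (by decide)
      (fun f k hk => by fin_cases f <;> first | exact sG k hk | exact s1 _ k rfl hk) 2 rfl rfl 4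
      (by rw [Fin.prod_univ_four]; decide)
    rw [Fin.prod_univ_four] at h; norm_num at h
    exact dvd_of_mul_dvd_mul (a := 4) (by norm_num) (by simpa [show (16 : ℤ) = 4 * 4 by norm_num] using h)
  · have h := LC ![cG, cG, cG, c1] ![gG, gG, gG, g1]
      (fun f x => by fin_cases f <;> first | exact lfun_cG x | exact lfun_c1 x) ![4, 4, 4, 1]
      (fun f x hx => by fin_cases f <;> first | exact dG x hx | exact d1 x hx) lw3 (by decide)
      (fun f k hk => by fin_cases f <;> first | exact sG k hk | exact s1 _ k rfl hk) 3 rfl rfl 8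
      (by rw [Fin.prod_univ_four]; decide)
    rw [Fin.prod_univ_four] at h; norm_num at h
    exact dvd_of_mul_dvd_mul (a := 8) (by norm_num) (by simpa [show (64 : ℤ) = 8 * 8 by norm_num] using h)
  · have h := LC ![cG, cG, cG, cP] ![gG, gG, gG, gP]
      (fun f x => by fin_cases f <;> first | exact lfun_cG x | exact lfun_cP x) ![4, 4, 4, 4]
      (fun f x hx => by fin_cases f <;> first | exact dG x hx | exact dP x hx) lw5 (by decide)
      (fun f k hk => by fin_cases f <;> first | exact sG k hk | exact sP _ k rfl hk) 3 rfl rfl 8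
      (by rw [Fin.prod_univ_four]; decide)
    rw [Fin.prod_univ_four] at h; norm_num at h
    exact dvd_of_mul_dvd_mul (a := 8) (by norm_num) (by simpa [show (256 : ℤ) = 8 * 32 by norm_num] using h)
  · have h := LC ![cG, cG, cP, cP] ![gG, gG, gP, gP]
      (fun f x => by fin_cases f <;> first | exact lfun_cG x | exact lfun_cP x) ![4, 4, 4, 4]
      (fun f x hx => by fin_cases f <;> first | exact dG x hx | exact dP x hx) lw6 (by decide)
      (fun f k hk => by fin_cases f <;> first | exact sG k hk | exact sP _ k rfl hk) 3 rfl rfl 4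
      (by rw [Fin.prod_univ_four]; decide)
    rw [Fin.prod_univ_four] at h; norm_num at h
    exact dvd_of_mul_dvd_mul (a := 4) (by norm_num) (by simpa [show (256 : ℤ) = 4 * 64 by norm_num] using h)
  · have h := LC ![cG, cP, cP, cP] ![gG, gP, gP, gP]
      (fun f x => by fin_cases f <;> first | exact lfun_cG x | exact lfun_cP x) ![4, 4, 4, 4]
      (fun f x hx => by fin_cases f <;> first | exact dG x hx | exact dP x hx) lw7 (by decide)
      (fun f k hk => by fin_cases f <;> first | exact sG k hk | exact sP _ k rfl hk) 3 rfl rfl 2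
      (by rw [Fin.prod_univ_four]; decide)
    rw [Fin.prod_univ_four] at h; norm_num at h
    exact dvd_of_mul_dvd_mul (a := 2) (by norm_num) (by simpa [show (256 : ℤ) = 2 * 128 by norm_num] using h)
  · have h := LC ![cP, cP, cP, cP] ![gP, gP, gP, gP]
      (fun f x => by fin_cases f <;> exact lfun_cP x) ![4, 4, 4, 4]
      (fun f x hx => by fin_cases f <;> exact dP x hx) lw8 (by decide)
      (fun f k hk => by fin_cases f <;> exact sP _ k rfl hk) 0 rfl rfl 1
      (by rw [Fin.prod_univ_four]; decide)
    rw [Fin.prod_univ_four] at h; norm_num at h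
    exact h

end Summit.HodgeConjecture.HodgeConjecture.Cruxes.BlochSeedDiscOne.HalfSum
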